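import Literature.AlgebraicGeometry.Motives.HodgeThetaAnnihilatorTimesRankOneTorus
import Literature.AlgebraicGeometry.Motives.HodgeThetaSubalgebraUnitaryQuartic
import HarnessLib

/-!
# Rational tensors on `V₁ ⊕ V₂` killed by `Θ` are killed by `ι₁ 𝔰𝔲_F(V₁, ψ₁)_ℂ π₁` when `End_Hdg(V₁) = F` is a QUARTIC CM FIELD acting with multiplicities `{(1,1),(2,0)}` and `V₂` is the `H¹` of a CM elliptic curve — with NO non-resonance hypothesis (Moonen–Zarhin 1999 §5 (5.11) Case 2 for `F = End⁰(Y) ⊋ k`: `Hg(E_k × Y) = {(u₁, u₂) ∈ U_k × U_F(V_Y, ψ) ∣ u₁² · det_k(u₂) = 1} ⊇ {1} × [U_F(V_Y, ψ), U_F(V_Y, ψ)]`, the Lie step)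

Family `hodge`, layer `Literature/AlgebraicGeometry/Motives` (abstract polarizable `ℚ`-Hodge structures; no
geometry). Research context: cell `pub-hodge-ring2` (HONEST FRAMING: research route conditional on HC_CM; not a
corollary; Q11.4-sentence-2 already refuted in dim ≥ 3), Literature lane (lit gen 65), programme R40 «`E × Y`, `Y` a
simple fourfold of Type IV(2,1), `End⁰(Y) = F` a quartic CM field CONTAINING `k = End⁰(E)`, `k` acting on `T_{Y,0}` with
multiplicities `(1,3)`» — the heir item H2 of the lane (Moonen–Zarhin Thm. 0.2 (3), case (g) with `End⁰(X₂) ⊋ k`),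
ABSTRACT HALF. UNCONDITIONAL linear algebra / Hodge theory; theorems only (no definition, no named fact, D-0026; nothing
admitted); no step towards a summit statement. It is the quartic companion of the lane's
`HodgeThetaAnnihilatorUnitaryTimesCMCurve` (R29: `End⁰(Y) = k` imaginary quadratic, multiplicities `(m,1)`), whose proof
it repeats VERBATIM up to the corner algebra, replacing THEOREM L′ (`UnitaryTheta.mem_spanC_of_commute_of_skew`) by the
tree's quartic theorem `QuarticTheta.mem_spanC_of_commute_of_skew` (`HodgeThetaSubalgebraUnitaryQuartic`: a rational Lie
subalgebra of `𝔲_F(V, ψ)` containing `Θ` after complexification is all of `𝔲_F(V, ψ)`, `F` quartic CM acting with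
multiplicities `{(1,1),(2,0)}` — Moonen–Zarhin Thm. (0.2)(4) for simple Type IV(2,1), `Hg(Y) = U_F(V_Y, ψ)`).

PRINTED RESULT, Lie-algebra form. B. Moonen, Yu. Zarhin, *Hodge classes on abelian varieties of low dimension*,
Math. Ann. 315 (1999) 711–733 [held: `paper:arxiv-math_9901113`], §5 (5.11) (chunk p0010 L66–L83, p0011 L1–L4), the
case `d_max = 4`: «let us assume that `d_max = 4`, i.e., that `Y` is simple (of Type 4). Write `k = End⁰(E)` and
`F = End⁰(Y)`. If there is no embedding `j : k ↪ F` then Proposition (3.8) gives `Hg(X) = Hg(E) × Hg(Y)`. Suppose then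
that there exists an embedding `j` … Case 2: Suppose that `k` acts on `T_{Y,0}` with multiplicities `(1,3)` … we find
that `Hg(X)` is contained in the subgroup `H ⊂ Hg(E) × Hg(Y) = U_k × U_F(V_Y,ψ)` given by
`H = {(u₁,u₂) ∈ U_k × U_F(V_Y,ψ) ∣ u₁² · det_k(u₂) = 1}` … Now remark that `U_k` has rank 1, so that the projection
`H → Hg(Y)` is an isogeny. As `H` is connected and `pr₂ : Hg(X) → Hg(Y)` is surjective, we conclude that `Hg(X) = H`»
— here `F ⊋ k` is a QUARTIC CM field (Type IV(2,1); for `[F:ℚ] = 8` the fourfold `Y` is of CM type), and `k` acting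
with multiplicities `(1,3)` means `F` acts with multiplicities `(n_σ) = (1,1,2,0)`. Consequence used downstream:
`Hg(X) ⊇ {1} × [U_F(V_Y,ψ), U_F(V_Y,ψ)]`; infinitesimally `hg(X) ⊇ 0 ⊕ [𝔲_F(V_Y,ψ), 𝔲_F(V_Y,ψ)]`
(`𝔲_F(V_Y,ψ)_ℂ ≅ 𝔤𝔩(W_{μ₁}) × 𝔤𝔩(W_{μ₂})`, derived algebra `𝔰𝔩₂ × 𝔰𝔩₂`). THIS is what the present file proves, in
the tree's word model and for an ARBITRARY CM elliptic curve `E` (resonant or not).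

THIS FILE. SETTING (that of `HodgeThetaAnnihilatorTimesRankOneTorus` §3 and of the R29 companion): a `ℚ`-space
`U = ι₁V₁ ⊕ ι₂V₂`, effective weight-one Hodge structures `H_U, H₁, H₂` (`ι_i` map pieces into pieces), polarizations
`ψ₁, ψ₂`; on `V₁` (`dim_ℚ V₁ = 8`) a quartic structure `φ₁ ∈ End_Hdg(V₁)` with `End_Hdg(V₁) = ℚ + ℚφ₁ + ℚφ₁² + ℚφ₁³` a
FIELD (every non-zero element has a left inverse), two eigenvalues `μ₁, μ₂` of `φ₁,ℂ` with `μ₁, μ̄₁, μ₂, μ̄₂` pairwise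
distinct and MULTIPLICITIES `dim(W_{μ₁} ∩ V₁^{1,0}) = dim(W_{μ₁} ∩ V₁^{0,1}) = 1`, `dim(W_{μ₂} ∩ V₁^{1,0}) = 2` — the
hypotheses of `QuarticTheta.mem_spanC_of_commute_of_skew` verbatim; on `V₂`, `dim V₂ = 2` and `φ₂ ∈ End_Hdg(V₂)` with
`φ₂² = -d₂ < 0` (the `H¹` of an elliptic curve with complex multiplication; `d₂` UNRELATED to `φ₁`). MAIN RESULT
(`wordDerAt_incl_bracket_proj_eq_zero_of_quarticUnitary_times_cmCurve`): every rational coefficient tensor `q` on `U`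
killed slice by slice by the matrix of `Θ_U` is killed by the matrix of `ι₁ ∘ [Y, Y'] ∘ π₁` for ALL `ψ₁,ℂ`-skew `Y, Y'`
commuting with `φ₁,ℂ` — «`0 ⊕ [𝔲_F(V₁, ψ₁), 𝔲_F(V₁, ψ₁)]_ℂ ⊆ Lie Hg(Y × E)_ℂ`» read on tensor invariants.

PROOF (the R29 proof verbatim up to the corner algebra, then the quartic theorem). Let `𝔞 = annLie(q)` (killing `q`;
commuting with `ι₁aπ₁` (`a ∈ End_Hdg V₁`), `ι₂φ₂π₂` and the two projectors; skew for `ψ₁(π₁·,π₁·) + ψ₂(π₂·,π₂·)`), so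
`Θ_U ∈ 𝔞_ℂ` (descent). The `V₂`-corners of `𝔞` are `ψ₂`-skew and commute with `φ₂`, hence lie on the line `ℚφ₂`
(`RankTwoCM.exists_eq_ratCast_smul_of_commute_of_skew`) and COMMUTE, so (Goursat step,
`bracket_eq_incl_corner_bracket_proj`) `[X, X'] = ι₁[c₁X, c₁X']π₁ ∈ 𝔞`, and the corner algebra `𝔤 = c₁(𝔞) ⊆ End(V₁)`
is a rational Lie algebra, commuting with `End_Hdg(V₁)`, `ψ₁`-skew, with `Θ₁ = c₁(Θ_U) ∈ 𝔤_ℂ`. By the QUARTIC THEOREM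
(`QuarticTheta.mem_spanC_of_commute_of_skew`) `𝔤_ℂ = 𝔲_F(V₁,ψ₁)_ℂ ∋ Y, Y'` («`pr₂ : Hg(X) → Hg(Y)` is surjective» with
«`Hg(Y) = U_F(V_Y,ψ)`»), and the complex Goursat step (`incl_bracket_proj_mem_spanC`) gives `ι₁[Y,Y']π₁ ∈ 𝔞_ℂ`, which
kills `q_ℂ`. («codimension 1» / «`Hg(X) = H`» is not needed for the derived part and is not claimed.)

WHAT IS NOT CLAIMED: the equality `Hg(X) = H`; anything geometric (the instantiation on `H¹(Y × E)` for an abelian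
fivefold of case (g), the vanishing of the Hodge classes in `H¹(E) ⊗ H³(Y)` and `B•(X) = D•(X)` are LEFT to the
geometric half, as `UnitaryTypeOneTimesCMCurveProductSpan` was for R29).

## References

* [MoonenZarhin1999LowDim] B. Moonen, Yu. Zarhin, Math. Ann. 315 (1999), §5 (5.11) Case 2 (arXiv v2 numbering: the `X ~ E × Y` paragraph; chunks p0010–p0011), §2 (2.5) `g = 4`,
  §3 (3.1), Thm. 0.2 (3) with (g), Thm. (0.2)(4) (held `paper:arxiv-math_9901113` chunks p0001, p0005, p0010–p0011).
  [cite: MoonenZarhin1999LowDim, §5 (5.11) Case 2]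
* [Deligne1982HodgeCycles] P. Deligne, LNM 900 (1982), I §3 Prop. 3.4 (descent; minimality). [cite: Deligne1982HodgeCycles, I §3 Prop. 3.4]
* [Lombardo2016] D. Lombardo, Ann. Inst. Fourier 66 (2016), Lemma 3.4 (p. 1229) (the Goursat step). [cite: Lombardo2016, Lemma 3.4 (p. 1229)]
-/

noncomputable section

open scoped TensorProduct
open CategoryTheory Module

namespace Literature.AlgebraicGeometry.Motives

namespace HodgeStructure

open Literature.RepresentationTheory.GeneralLinear

universe u

section Main

variable {U V₁ V₂ : Type u} [AddCommGroup U] [Module ℚ U] [AddCommGroup V₁] [Module ℚ V₁]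
  [AddCommGroup V₂] [Module ℚ V₂] [Module.Finite ℚ U] [Module.Finite ℚ V₁] [Module.Finite ℚ V₂]
  [HodgeTensorFacts.{u, u}] {n : ℤ}
variable {M d m : ℕ}

omit [Module.Finite ℚ U] [Module.Finite ℚ V₁] [Module.Finite ℚ V₂] [HodgeTensorFacts.{u, u}] in
/-- Complexification of a sum of bilinear forms, evaluated (a copy of the private lemma of
`HodgeThetaAnnihilatorTimesRankOneTorus`, as in the R29 companion). [folklore] -/
private theorem baseChange_add_apply_quartic (B B' : LinearMap.BilinForm ℚ U) (x y : ℂ ⊗[ℚ] U) :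
    LinearMap.BilinForm.baseChange ℂ (B + B') x y =
      LinearMap.BilinForm.baseChange ℂ B x y + LinearMap.BilinForm.baseChange ℂ B' x y := by
  induction x using TensorProduct.induction_on with
  | zero => simp
  | tmul c v =>
    induction y using TensorProduct.induction_on with
    | zero => simp
    | tmul d w =>
      simp only [LinearMap.BilinForm.baseChange_tmul, LinearMap.add_apply, add_smul]
    | add y y' hy hy' => rw [map_add, map_add, map_add, hy, hy']; abel
  | add x x' hx hx' =>
    rw [map_add, LinearMap.add_apply, map_add, map_add, LinearMap.add_apply, LinearMap.add_apply, hx, hx']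
    abel

/-- **Theorem (Moonen–Zarhin 1999 §5 (5.11) Case 2 with `F = End⁰(Y)` a quartic CM field, Lie step, word model): the
derived part `0 ⊕ [𝔲_F(V₁, ψ₁), 𝔲_F(V₁, ψ₁)]` of `Lie Hg(Y × E)` for `Y` of Type IV(2,1) with multiplicities `{(1,1),(2,0)}`
and `E` ANY CM elliptic curve.** Let `U = ι₁V₁ ⊕ ι₂V₂` be a presentation compatible with effective weight-one Hodge
structures `H_U, H₁, H₂`, polarizations `ψ₁, ψ₂`; `dim_ℚ V₁ = 8`, `φ₁ ∈ End_Hdg(V₁)` with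
`End_Hdg(V₁) = ℚ + ℚφ₁ + ℚφ₁² + ℚφ₁³` a field («`End⁰(Y) = F` a quartic CM field»), eigenvalues `μ₁, μ₂` of `φ₁,ℂ` with
`μ₁, μ̄₁, μ₂, μ̄₂` pairwise distinct and `dim(W_{μ₁} ∩ V₁^{1,0}) = dim(W_{μ₁} ∩ V₁^{0,1}) = 1`, `dim(W_{μ₂} ∩ V₁^{1,0}) = 2`
(«`k ⊂ F` acts on `T_{Y,0}` with multiplicities `(1,3)`»: `F`-multiplicities `(1,1,2,0)`); `dim V₂ = 2` with
`φ₂ ∈ End_Hdg(V₂)`, `φ₂² = -d₂ < 0` («`E` an elliptic curve with complex multiplication», possibly by `k ⊂ F`). Then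
every RATIONAL coefficient tensor `q` on `U` killed slice by slice by the matrix of `Θ_U` is killed by the matrix of
`ι₁ ∘ (Y Y' - Y' Y) ∘ π₁` for all `Y, Y' ∈ End_ℂ(V₁,ℂ)` commuting with `φ₁,ℂ` and `ψ₁,ℂ`-skew
(`Y, Y' ∈ 𝔲_F(V₁, ψ₁)_ℂ ≅ 𝔤𝔩(W_{μ₁}) × 𝔤𝔩(W_{μ₂})`): «`Hg(X) = {(u₁,u₂) ∈ U_k × U_F(V_Y,ψ) ∣ u₁² · det_k(u₂) = 1} ⊇
{1} × [U_F, U_F]`», read on tensor invariants. Proof: the corner algebra `𝔤 = c₁(annLie q)` is a rational Lie algebra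
containing `Θ₁` after complexification (Goursat step over the rank-one torus `ℚφ₂`), so `𝔤_ℂ = 𝔲_F(V₁,ψ₁)_ℂ` by
`QuarticTheta.mem_spanC_of_commute_of_skew` («`pr₂ : Hg(X) → Hg(Y) = U_F(V_Y,ψ)` is surjective») and
`ι₁[𝔤_ℂ, 𝔤_ℂ]π₁ ⊆ (annLie q)_ℂ`. [cite: MoonenZarhin1999LowDim, §5 (5.11) Case 2]
[cite: MoonenZarhin1999LowDim, §2 (2.5) and §3 (3.1)] [cite: Deligne1982HodgeCycles, I §3 Prop. 3.4]
[cite: Lombardo2016, Lemma 3.4 (p. 1229)] -/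
theorem wordDerAt_incl_bracket_proj_eq_zero_of_quarticUnitary_times_cmCurve (hn : n = 1) (HU : HodgeStructure U n)
    (H₁ : HodgeStructure V₁ n) (H₂ : HodgeStructure V₂ n) (heff₁ : H₁.IsEffective) (heff₂ : H₂.IsEffective)
    {ι₁ : V₁ →ₗ[ℚ] U} {π₁ : U →ₗ[ℚ] V₁} {ι₂ : V₂ →ₗ[ℚ] U} {π₂ : U →ₗ[ℚ] V₂}
    (hπι₁ : π₁ ∘ₗ ι₁ = LinearMap.id) (hπι₂ : π₂ ∘ₗ ι₂ = LinearMap.id) (hπ₁ι₂ : π₁ ∘ₗ ι₂ = 0)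
    (hπ₂ι₁ : π₂ ∘ₗ ι₁ = 0) (hsum : ι₁ ∘ₗ π₁ + ι₂ ∘ₗ π₂ = LinearMap.id)
    (hι₁F : ∀ p, ∀ x ∈ H₁.piece p (n - p), ι₁.baseChange ℂ x ∈ HU.piece p (n - p))
    (hι₂F : ∀ p, ∀ x ∈ H₂.piece p (n - p), ι₂.baseChange ℂ x ∈ HU.piece p (n - p))
    (ψ₁ : H₁.Polarization) (ψ₂ : H₂.Polarization)
    {φ₁ : Module.End ℚ V₁} (hφ₁E : φ₁ ∈ H₁.endAlg)
    (hE₁ : ∀ a ∈ H₁.endAlg, ∃ c : Fin 4 → ℚ, a = ∑ k, c k • φ₁ ^ (k : ℕ))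
    (hdiv₁ : ∀ a ∈ H₁.endAlg, a ≠ 0 → ∃ b : Module.End ℚ V₁, b * a = 1) {μ₁ μ₂ : ℂ}
    (h11 : starRingEnd ℂ μ₁ ≠ μ₁) (h22 : starRingEnd ℂ μ₂ ≠ μ₂) (h12 : μ₂ ≠ μ₁)
    (h12' : μ₂ ≠ starRingEnd ℂ μ₁) (hV₁ : Module.finrank ℚ V₁ = 8)
    (h1a : Module.finrank ℂ ↥(Module.End.eigenspace (φ₁.baseChange ℂ) μ₁ ⊓ H₁.piece 1 0) = 1)
    (h1b : Module.finrank ℂ ↥(Module.End.eigenspace (φ₁.baseChange ℂ) μ₁ ⊓ H₁.piece 0 1) = 1)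
    (h2a : Module.finrank ℂ ↥(Module.End.eigenspace (φ₁.baseChange ℂ) μ₂ ⊓ H₁.piece 1 0) = 2)
    {φ₂ : Module.End ℚ V₂} (hφ₂E : φ₂ ∈ H₂.endAlg) {d₂ : ℚ} (hd₂ : 0 < d₂) (hφ₂ : φ₂ * φ₂ = -(d₂ • 1))
    (hV₂ : Module.finrank ℚ V₂ = 2)
    (eQ : Module.Basis (Fin M) ℚ U) (q : (Fin d → Fin m × Fin M) → ℚ)
    {ΘU : Module.End ℂ (ℂ ⊗[ℚ] U)} (hΘU : ∀ p, ∀ x ∈ HU.piece p (n - p), ΘU x = ((2 * p - n : ℤ) : ℂ) • x)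
    {Θ₁ : Module.End ℂ (ℂ ⊗[ℚ] V₁)} (hΘ₁ : ∀ p, ∀ x ∈ H₁.piece p (n - p), Θ₁ x = ((2 * p - n : ℤ) : ℂ) • x)
    {Θ₂ : Module.End ℂ (ℂ ⊗[ℚ] V₂)} (hΘ₂ : ∀ p, ∀ x ∈ H₂.piece p (n - p), Θ₂ x = ((2 * p - n : ℤ) : ℂ) • x)
    (hΘq : ∀ u : Fin d → Fin m, wordDerAt ℂ (fun _ : Fin d =>
      LinearMap.toMatrix (Algebra.TensorProduct.basis ℂ eQ) (Algebra.TensorProduct.basis ℂ eQ) ΘU)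
      (wordSlice (fun w => algebraMap ℚ ℂ (q w)) u) = 0)
    {Y Y' : Module.End ℂ (ℂ ⊗[ℚ] V₁)} (hYφ : Y * φ₁.baseChange ℂ = φ₁.baseChange ℂ * Y)
    (hYskew : ∀ x y, ψ₁.form.baseChange ℂ (Y x) y + ψ₁.form.baseChange ℂ x (Y y) = 0)
    (hY'φ : Y' * φ₁.baseChange ℂ = φ₁.baseChange ℂ * Y')
    (hY'skew : ∀ x y, ψ₁.form.baseChange ℂ (Y' x) y + ψ₁.form.baseChange ℂ x (Y' y) = 0)
    (u : Fin d → Fin m) :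
    wordDerAt ℂ (fun _ : Fin d =>
      LinearMap.toMatrix (Algebra.TensorProduct.basis ℂ eQ) (Algebra.TensorProduct.basis ℂ eQ)
        (ι₁.baseChange ℂ ∘ₗ (Y * Y' - Y' * Y) ∘ₗ π₁.baseChange ℂ))
      (wordSlice (fun w => algebraMap ℚ ℂ (q w)) u) = 0 := by
  classical
  have hΘ₁C : Θ₁ ∈ H₁.hodgeLieC := H₁.mem_hodgeLieC_of_forall_piece hΘ₁
  have hΘ₂C : Θ₂ ∈ H₂.hodgeLieC := H₂.mem_hodgeLieC_of_forall_piece hΘ₂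
  have hsum' : ι₂ ∘ₗ π₂ + ι₁ ∘ₗ π₁ = LinearMap.id := by rw [add_comm]; exact hsum
  -- pointwise slot identities
  have e11 : ∀ v, π₁ (ι₁ v) = v := fun v => by
    rw [← LinearMap.comp_apply (f := π₁), hπι₁, LinearMap.id_apply]
  have e22 : ∀ w, π₂ (ι₂ w) = w := fun w => by
    rw [← LinearMap.comp_apply (f := π₂), hπι₂, LinearMap.id_apply]
  have e12 : ∀ w, π₁ (ι₂ w) = 0 := fun w => by
    rw [← LinearMap.comp_apply (f := π₁), hπ₁ι₂, LinearMap.zero_apply]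
  have e21 : ∀ v, π₂ (ι₁ v) = 0 := fun v => by
    rw [← LinearMap.comp_apply (f := π₂), hπ₂ι₁, LinearMap.zero_apply]
  -- `Θ` through the presentation
  have hΘι₁ := theta_incl_eq HU H₁ hι₁F hΘU hΘ₁
  have hΘι₂ := theta_incl_eq HU H₂ hι₂F hΘU hΘ₂
  have hΘπ₁ := proj_theta_eq HU H₁ H₂ hπι₁ hπ₁ι₂ hsum hι₁F hι₂F hΘU hΘ₁ hΘ₂
  have hΘπ₂ := proj_theta_eq HU H₂ H₁ hπι₂ hπ₂ι₁ hsum' hι₂F hι₁F hΘU hΘ₂ hΘ₁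
  -- the commuting family: `ι₁ a π₁` (`a ∈ End_Hdg V₁`), `ι₂ φ₂ π₂`, the two projectors; the orthogonal-sum form
  set aF : (H₁.endAlg ⊕ Unit) ⊕ (Unit ⊕ Unit) → Module.End ℚ U :=
    Sum.elim (Sum.elim (fun a => ι₁ ∘ₗ (a : Module.End ℚ V₁) ∘ₗ π₁) (fun _ => ι₂ ∘ₗ φ₂ ∘ₗ π₂))
      (Sum.elim (fun _ => ι₁ ∘ₗ π₁) (fun _ => ι₂ ∘ₗ π₂)) with haF
  set φ : LinearMap.BilinForm ℚ U := ψ₁.form.compl₁₂ π₁ π₁ + ψ₂.form.compl₁₂ π₂ π₂ with hφ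
  have hφC : ∀ x y, φ.baseChange ℂ x y = ψ₁.form.baseChange ℂ (π₁.baseChange ℂ x) (π₁.baseChange ℂ y) +
      ψ₂.form.baseChange ℂ (π₂.baseChange ℂ x) (π₂.baseChange ℂ y) := fun x y => by
    rw [hφ, baseChange_add_apply_quartic, baseChange_compl₁₂_apply, baseChange_compl₁₂_apply]
  have hφapply : ∀ x y, φ x y = ψ₁.form (π₁ x) (π₁ y) + ψ₂.form (π₂ x) (π₂ y) := fun x y => by
    rw [hφ, LinearMap.add_apply, LinearMap.add_apply, LinearMap.compl₁₂_apply, LinearMap.compl₁₂_apply]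
  set 𝔞 : Submodule ℚ (Module.End ℚ U) := annLie φ eQ aF q with h𝔞
  -- `Θ_U ∈ 𝔞_ℂ`
  have hΘ𝔞 : ΘU ∈ spanC 𝔞 := by
    refine mem_spanC_annLie φ eQ aF q hΘq (fun i => ?_) (fun x y => ?_)
    · apply LinearMap.ext
      intro y
      rcases i with (a | _) | (_ | _)
      · change ΘU ((ι₁ ∘ₗ (a : Module.End ℚ V₁) ∘ₗ π₁).baseChange ℂ y) =
          (ι₁ ∘ₗ (a : Module.End ℚ V₁) ∘ₗ π₁).baseChange ℂ (ΘU y)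
        simp only [LinearMap.baseChange_comp, LinearMap.comp_apply]
        rw [hΘι₁, ← Module.End.mul_apply (f := Θ₁), commute_baseChange_of_mem_hodgeLieC H₁ hΘ₁C a,
          Module.End.mul_apply, hΘπ₁]
      · change ΘU ((ι₂ ∘ₗ φ₂ ∘ₗ π₂).baseChange ℂ y) = (ι₂ ∘ₗ φ₂ ∘ₗ π₂).baseChange ℂ (ΘU y)
        simp only [LinearMap.baseChange_comp, LinearMap.comp_apply]
        rw [hΘι₂, ← Module.End.mul_apply (f := Θ₂), commute_baseChange_of_mem_hodgeLieC H₂ hΘ₂C ⟨φ₂, hφ₂E⟩,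
          Module.End.mul_apply, hΘπ₂]
      · change ΘU ((ι₁ ∘ₗ π₁).baseChange ℂ y) = (ι₁ ∘ₗ π₁).baseChange ℂ (ΘU y)
        simp only [LinearMap.baseChange_comp, LinearMap.comp_apply]
        rw [hΘι₁, hΘπ₁]
      · change ΘU ((ι₂ ∘ₗ π₂).baseChange ℂ y) = (ι₂ ∘ₗ π₂).baseChange ℂ (ΘU y)
        simp only [LinearMap.baseChange_comp, LinearMap.comp_apply]
        rw [hΘι₂, hΘπ₂]
    · rw [hφC, hφC, hΘπ₁, hΘπ₁, hΘπ₂, hΘπ₂, formBaseChange_skew_of_mem_hodgeLieC ψ₁ hΘ₁C,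
        formBaseChange_skew_of_mem_hodgeLieC ψ₂ hΘ₂C]
      ring
  -- what membership in `𝔞` gives
  have hmem : ∀ X ∈ 𝔞, (∀ i, X * aF i = aF i * X) ∧ ∀ v w, φ (X v) w + φ v (X w) = 0 :=
    fun X hX => ((mem_annLie_iff φ eQ aF q X).1 hX).2
  have hP₁ : ∀ X ∈ 𝔞, X * (ι₁ ∘ₗ π₁) = (ι₁ ∘ₗ π₁) * X := fun X hX => (hmem X hX).1 (Sum.inr (Sum.inl ()))
  have hP₂ : ∀ X ∈ 𝔞, X * (ι₂ ∘ₗ π₂) = (ι₂ ∘ₗ π₂) * X := fun X hX => (hmem X hX).1 (Sum.inr (Sum.inr ()))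
  have hTa : ∀ X ∈ 𝔞, ∀ a : H₁.endAlg, X * (ι₁ ∘ₗ (a : Module.End ℚ V₁) ∘ₗ π₁) =
      (ι₁ ∘ₗ (a : Module.End ℚ V₁) ∘ₗ π₁) * X := fun X hX a => (hmem X hX).1 (Sum.inl (Sum.inl a))
  have hTφ₂ : ∀ X ∈ 𝔞, X * (ι₂ ∘ₗ φ₂ ∘ₗ π₂) = (ι₂ ∘ₗ φ₂ ∘ₗ π₂) * X :=
    fun X hX => (hmem X hX).1 (Sum.inl (Sum.inr ()))
  -- the corners commute with `End_Hdg(V₁)` resp. `φ₂`, and are skew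
  have hc₁comm : ∀ X ∈ 𝔞, ∀ a : H₁.endAlg, (π₁ ∘ₗ X ∘ₗ ι₁) * (a : Module.End ℚ V₁) =
      (a : Module.End ℚ V₁) * (π₁ ∘ₗ X ∘ₗ ι₁) := by
    intro X hX a
    apply LinearMap.ext
    intro v
    have h := congrArg (fun f : Module.End ℚ U => π₁ (f (ι₁ v))) (hTa X hX a)
    simp only [Module.End.mul_apply, LinearMap.comp_apply, e11] at h
    simp only [Module.End.mul_apply, LinearMap.comp_apply]
    exact h
  have hc₂comm : ∀ X ∈ 𝔞, (π₂ ∘ₗ X ∘ₗ ι₂) * φ₂ = φ₂ * (π₂ ∘ₗ X ∘ₗ ι₂) := by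
    intro X hX
    apply LinearMap.ext
    intro w
    have h := congrArg (fun g : Module.End ℚ U => π₂ (g (ι₂ w))) (hTφ₂ X hX)
    simp only [Module.End.mul_apply, LinearMap.comp_apply, e22] at h
    simp only [Module.End.mul_apply, LinearMap.comp_apply]
    exact h
  have hc₁skew : ∀ X ∈ 𝔞, ∀ v w, ψ₁.form ((π₁ ∘ₗ X ∘ₗ ι₁) v) w + ψ₁.form v ((π₁ ∘ₗ X ∘ₗ ι₁) w) = 0 := by
    intro X hX v w
    have h := (hmem X hX).2 (ι₁ v) (ι₁ w)
    rw [apply_incl_eq_of_commute_projector hπι₁ (hP₁ X hX) v,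
      apply_incl_eq_of_commute_projector hπι₁ (hP₁ X hX) w, hφapply, hφapply] at h
    simp only [e11, e21, map_zero, add_zero] at h
    simpa only [LinearMap.comp_apply] using h
  have hc₂skew : ∀ X ∈ 𝔞, ∀ v w, ψ₂.form ((π₂ ∘ₗ X ∘ₗ ι₂) v) w + ψ₂.form v ((π₂ ∘ₗ X ∘ₗ ι₂) w) = 0 := by
    intro X hX v w
    have h := (hmem X hX).2 (ι₂ v) (ι₂ w)
    rw [apply_incl_eq_of_commute_projector hπι₂ (hP₂ X hX) v,
      apply_incl_eq_of_commute_projector hπι₂ (hP₂ X hX) w, hφapply, hφapply] at h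
    simp only [e22, e12, map_zero, zero_add] at h
    simpa only [LinearMap.comp_apply] using h
  -- the `V₂`-corners lie on the line `ℚφ₂` (rank-one torus), hence commute
  have hc₂line : ∀ X ∈ 𝔞, ∃ c : ℚ, π₂ ∘ₗ X ∘ₗ ι₂ = c • φ₂ := fun X hX =>
    RankTwoCM.exists_eq_ratCast_smul_of_commute_of_skew H₂ hn heff₂ hV₂ ψ₂ hφ₂E hd₂ hφ₂ (hc₂comm X hX)
      (hc₂skew X hX)
  have hc₂c : ∀ X ∈ 𝔞, ∀ X' ∈ 𝔞,
      (π₂ ∘ₗ X ∘ₗ ι₂) * (π₂ ∘ₗ X' ∘ₗ ι₂) = (π₂ ∘ₗ X' ∘ₗ ι₂) * (π₂ ∘ₗ X ∘ₗ ι₂) := by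
    intro X hX X' hX'
    obtain ⟨c, hc⟩ := hc₂line X hX
    obtain ⟨c', hc'⟩ := hc₂line X' hX'
    rw [hc, hc', smul_mul_assoc, mul_smul_comm, smul_mul_assoc, mul_smul_comm, smul_comm]
  -- the Goursat step inside `𝔞`
  have hbr𝔞 : ∀ X ∈ 𝔞, ∀ X' ∈ 𝔞,
      ι₁ ∘ₗ ((π₁ ∘ₗ X ∘ₗ ι₁) * (π₁ ∘ₗ X' ∘ₗ ι₁) - (π₁ ∘ₗ X' ∘ₗ ι₁) * (π₁ ∘ₗ X ∘ₗ ι₁)) ∘ₗ π₁ ∈ 𝔞 := by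
    intro X hX X' hX'
    rw [← bracket_eq_incl_corner_bracket_proj hπι₁ hπι₂ hsum (hP₁ X hX) (hP₂ X hX) (hP₁ X' hX') (hP₂ X' hX')
      (hc₂c X hX X' hX')]
    exact commutator_mem_annLie φ eQ aF q hX hX'
  -- the corner algebra `𝔤 = c₁(𝔞)`
  obtain ⟨cLin, hcLin⟩ : ∃ L : Module.End ℚ U →ₗ[ℚ] Module.End ℚ V₁, ∀ X, L X = π₁ ∘ₗ X ∘ₗ ι₁ :=
    ⟨{ toFun := fun X => π₁ ∘ₗ X ∘ₗ ι₁
       map_add' := fun X X' => by rw [LinearMap.add_comp, LinearMap.comp_add]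
       map_smul' := fun c X => by rw [LinearMap.smul_comp, LinearMap.comp_smul, RingHom.id_apply] },
      fun X => rfl⟩
  set 𝔤 : Submodule ℚ (Module.End ℚ V₁) := 𝔞.map cLin with h𝔤
  have h𝔤mem : ∀ {Z}, Z ∈ 𝔤 ↔ ∃ X ∈ 𝔞, π₁ ∘ₗ X ∘ₗ ι₁ = Z := by
    intro Z
    rw [h𝔤, Submodule.mem_map]
    simp only [hcLin]
  have hbr𝔤 : ∀ Z ∈ 𝔤, ∀ Z' ∈ 𝔤, Z * Z' - Z' * Z ∈ 𝔤 := by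
    intro Z hZ Z' hZ'
    obtain ⟨X, hX, rfl⟩ := h𝔤mem.1 hZ
    obtain ⟨X', hX', rfl⟩ := h𝔤mem.1 hZ'
    refine h𝔤mem.2 ⟨_, hbr𝔞 X hX X' hX', ?_⟩
    apply LinearMap.ext
    intro v
    simp only [LinearMap.comp_apply, LinearMap.sub_apply, Module.End.mul_apply, e11]
  have hcomm𝔤 : ∀ Z ∈ 𝔤, ∀ a : H₁.endAlg, Z * (a : Module.End ℚ V₁) = (a : Module.End ℚ V₁) * Z := by
    intro Z hZ a
    obtain ⟨X, hX, rfl⟩ := h𝔤mem.1 hZ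
    exact hc₁comm X hX a
  have hskew𝔤 : ∀ Z ∈ 𝔤, ∀ v w, ψ₁.form (Z v) w + ψ₁.form v (Z w) = 0 := by
    intro Z hZ v w
    obtain ⟨X, hX, rfl⟩ := h𝔤mem.1 hZ
    exact hc₁skew X hX v w
  have hspanC𝔤 : spanC 𝔤 = Submodule.span ℂ
      ((fun X : Module.End ℚ U => (π₁ ∘ₗ X ∘ₗ ι₁).baseChange ℂ) '' (𝔞 : Set _)) := by
    rw [spanC, h𝔤, Submodule.map_coe, Set.image_image]
    simp only [hcLin]
  -- `Θ₁ = c₁(Θ_U) ∈ 𝔤_ℂ`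
  have hcorner : ∀ T ∈ spanC 𝔞, π₁.baseChange ℂ ∘ₗ T ∘ₗ ι₁.baseChange ℂ ∈ spanC 𝔤 := by
    intro T hT
    induction hT using Submodule.span_induction with
    | mem Z hZ =>
      obtain ⟨X, hX, rfl⟩ := hZ
      rw [← LinearMap.baseChange_comp, ← LinearMap.baseChange_comp]
      exact baseChange_mem_spanC (h𝔤mem.2 ⟨X, hX, rfl⟩)
    | zero => rw [LinearMap.zero_comp, LinearMap.comp_zero]; exact Submodule.zero_mem _
    | add Z Z' _ _ hZ hZ' => rw [LinearMap.add_comp, LinearMap.comp_add]; exact Submodule.add_mem _ hZ hZ'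
    | smul c Z _ hZ => rw [LinearMap.smul_comp, LinearMap.comp_smul]; exact Submodule.smul_mem _ c hZ
  have hΘ₁𝔤 : Θ₁ ∈ spanC 𝔤 := by
    have h : Θ₁ = π₁.baseChange ℂ ∘ₗ ΘU ∘ₗ ι₁.baseChange ℂ := by
      apply LinearMap.ext
      intro x
      rw [LinearMap.comp_apply, LinearMap.comp_apply, hΘι₁, proj_incl_baseChange hπι₁]
    rw [h]
    exact hcorner ΘU hΘ𝔞
  -- NEW: by the QUARTIC theorem the corner algebra is all of `𝔲_F(V₁, ψ₁)` after complexification: `Y, Y' ∈ 𝔤_ℂ`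
  have hY𝔤 : Y ∈ spanC 𝔤 :=
    QuarticTheta.mem_spanC_of_commute_of_skew H₁ hn heff₁ ψ₁ hφ₁E hE₁ hdiv₁ h11 h22 h12 h12' hV₁ h1a h1b h2a 𝔤 hbr𝔤
      hΘ₁ hΘ₁𝔤 hcomm𝔤 hskew𝔤 hYφ hYskew
  have hY'𝔤 : Y' ∈ spanC 𝔤 :=
    QuarticTheta.mem_spanC_of_commute_of_skew H₁ hn heff₁ ψ₁ hφ₁E hE₁ hdiv₁ h11 h22 h12 h12' hV₁ h1a h1b h2a 𝔤 hbr𝔤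
      hΘ₁ hΘ₁𝔤 hcomm𝔤 hskew𝔤 hY'φ hY'skew
  -- the complex Goursat step: `ι₁ [Y, Y'] π₁ ∈ 𝔞_ℂ`
  have hgoal : ι₁.baseChange ℂ ∘ₗ (Y * Y' - Y' * Y) ∘ₗ π₁.baseChange ℂ ∈ spanC 𝔞 := by
    rw [hspanC𝔤] at hY𝔤 hY'𝔤
    exact incl_bracket_proj_mem_spanC 𝔞 hbr𝔞 hY𝔤 hY'𝔤
  exact wordDerAt_eq_zero_of_mem_spanC_annLie φ eQ aF q hgoal u

end Main

end HodgeStructure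

end Literature.AlgebraicGeometry.Motives

end
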